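import Literature.NumberTheory.GaloisRepresentations.GaloisRep
import HarnessLib

/-!
# Spin lifts of six-dimensional special orthogonal `ℓ`-adic Galois representations, without a
# ramification hypothesis (Patrikis 2019, §2.1, the Proposition alone)

Topic `Literature/NumberTheory/GaloisRepresentations`; ONE named fact (result in print,
`def … : Prop`, D-0014), companion of `Patrikis2019_exists_spinLift` (`TateSpinLift.lean`).

The printed Proposition (S. Patrikis, *Variations on a theorem of Tate*, Mem. Amer. Math. Soc.
258 (2019), no. 1238, Ch. 2 §2.1 "Review of lifting results" = arXiv:1207.6724 Prop. 1.0.18 of the held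
text (read 2026-08-15, p0014), attributed there to B. Conrad, *Lifting global representations
with local properties*, Prop. 5.3) reads: "Let `H' ↠ H` be a
surjection of linear algebraic groups over `ℚ̄_ℓ` with kernel a central torus. Then ANY continuous
representation `ρ : Γ_F → H(ℚ̄_ℓ)` lifts to `H'(ℚ̄_ℓ)`" — there is no ramification hypothesis; the
almost-everywhere-unramified refinement is the separate Remark following it (arXiv Remark 1.0.19,
third item = Conrad, Lemma 5.2),
and continuous `ℓ`-adic representations of `Γ_F` need not be unramified almost everywhere
(Ramakrishna's infinitely ramified representations), so the two statements are genuinely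
different. `TateSpinLift.lean` vendors the Proposition TOGETHER with the Remark (hypothesis: `r`
unramified a.e.; conclusion: `W` unramified a.e.), read through `D₃ = A₃`
(`H' = GSpin₆ = {(h, t) ∈ GL₄ × 𝔾_m : det h = t²} ↠ SO₆`, kernel `𝔾_m`; see that module docstring
for the linear algebra). This file vendors the Proposition ALONE through the same isogeny: every
continuous `r : Γ_F → GL₆(ℚ̄_ℓ)` preserving a non-degenerate symmetric form with `det r = 1` has a
continuous `W : Γ_F → GL₄(ℚ̄_ℓ)` and a continuous character `ν` with `∧²W ≅ ν ⊗ r` in trace form.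
This is the shape consumed verbatim by conjunct (i) of the route item
`Summit.Langlands.Langlands.Theses.K3KugaSatakeDescent.EvenSectorNotPolarized`
(`stmt-Langlands-3801`), which carries no ramification hypothesis (grounds it: item (i) = this
fact at `F = ℚ`).

## References

* [Patrikis2019] S. Patrikis, *Variations on a theorem of Tate*, Mem. AMS 258 (2019), no. 1238:
  Ch. 2 §2.1, Proposition (lifting through central torus quotients).
-/

noncomputable section

namespace Literature.NumberTheory.GaloisRepresentations

open Field IsDedekindDomain
open scoped NumberField Matrix

/-- **Spin lifts of six-dimensional special orthogonal `ℓ`-adic Galois representations, for every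
continuous `r`** (Patrikis 2019, Ch. 2 §2.1, the Proposition "lifting through central torus
quotients" = Conrad, Prop. 5.3: "any continuous representation `ρ : Γ_F → H(ℚ̄_ℓ)` lifts to
`H'(ℚ̄_ℓ)`" for `H' ↠ H` with central torus kernel, applied to `GSpin₆ ↠ SO₆` and read through
`D₃ = A₃` as in `Patrikis2019_exists_spinLift`), NAMED FACT. For a number field `F`, a prime `ℓ`
and a continuous `r : Γ_F → GL₆(ℚ̄_ℓ)` which preserves a non-degenerate symmetric bilinear form
`J` (`r(σ)ᵀ J r(σ) = J`) and has `det r = 1`, there are a continuous `W : Γ_F → GL₄(ℚ̄_ℓ)` and a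
continuous character `ν : Γ_F → ℚ̄_ℓ^×` with `∧²W ≅ ν ⊗ r` in the form of the trace identity
`ν(σ) · tr r(σ) = ((tr W(σ))² − tr W(σ²)) / 2` for all `σ ∈ Γ_F`. No ramification hypothesis and
no ramification conclusion (for those see `Patrikis2019_exists_spinLift`). Grounds conjunct (i) of
`Summit.Langlands.Langlands.Theses.K3KugaSatakeDescent.EvenSectorNotPolarized`.
[cite: Patrikis2019, Ch. 2 §2.1, Proposition (lifting through central torus quotients) = arXiv:1207.6724 Prop. 1.0.18 = Conrad Prop. 5.3] -/
def Patrikis2019_exists_spinLift_of_continuous : Prop :=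
  ∀ (F : Type) [Field F] [NumberField F] (ℓ : ℕ) [Fact ℓ.Prime]
    (r : FramedGaloisRep F (PadicAlgCl ℓ) 6),
    (∃ J : Matrix (Fin 6) (Fin 6) (PadicAlgCl ℓ), J.IsSymm ∧ IsUnit J ∧
      ∀ σ, ((r σ : GL (Fin 6) (PadicAlgCl ℓ)) : Matrix (Fin 6) (Fin 6) (PadicAlgCl ℓ))ᵀ * J *
        ((r σ : GL (Fin 6) (PadicAlgCl ℓ)) : Matrix (Fin 6) (Fin 6) (PadicAlgCl ℓ)) = J) →
    (∀ σ, FramedRep.det r σ = 1) →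
      ∃ (W : FramedGaloisRep F (PadicAlgCl ℓ) 4) (ν : absoluteGaloisGroup F →ₜ* (PadicAlgCl ℓ)ˣ),
        ∀ σ, (ν σ : PadicAlgCl ℓ) * FramedRep.trace r σ =
            (FramedRep.trace W σ ^ 2 - FramedRep.trace W (σ * σ)) / 2

/-! ### API -/

section API

variable {F : Type} [Field F] [NumberField F] {ℓ : ℕ} [Fact ℓ.Prime]

/-- The fact in the form consumed for a FIXED `r` (all quantifiers instantiated).
[cite: Patrikis2019, Ch. 2 §2.1] -/
theorem Patrikis2019_exists_spinLift_of_continuous.apply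
    (h : Patrikis2019_exists_spinLift_of_continuous)
    (r : FramedGaloisRep F (PadicAlgCl ℓ) 6)
    (hJ : ∃ J : Matrix (Fin 6) (Fin 6) (PadicAlgCl ℓ), J.IsSymm ∧ IsUnit J ∧
      ∀ σ, ((r σ : GL (Fin 6) (PadicAlgCl ℓ)) : Matrix (Fin 6) (Fin 6) (PadicAlgCl ℓ))ᵀ * J *
        ((r σ : GL (Fin 6) (PadicAlgCl ℓ)) : Matrix (Fin 6) (Fin 6) (PadicAlgCl ℓ)) = J)
    (hdet : ∀ σ, FramedRep.det r σ = 1) :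
    ∃ (W : FramedGaloisRep F (PadicAlgCl ℓ) 4) (ν : absoluteGaloisGroup F →ₜ* (PadicAlgCl ℓ)ˣ),
      ∀ σ, (ν σ : PadicAlgCl ℓ) * FramedRep.trace r σ =
          (FramedRep.trace W σ ^ 2 - FramedRep.trace W (σ * σ)) / 2 :=
  h F ℓ r hJ hdet

/-- The ramification-free Proposition gives the lift-existence half of the bundled fact
`Patrikis2019_exists_spinLift` (drop its unramifiedness hypothesis and conclusion). [folklore] -/
theorem Patrikis2019_exists_spinLift_of_continuous.exists_of_unramified
    (h : Patrikis2019_exists_spinLift_of_continuous)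
    (r : FramedGaloisRep F (PadicAlgCl ℓ) 6)
    (hJ : ∃ J : Matrix (Fin 6) (Fin 6) (PadicAlgCl ℓ), J.IsSymm ∧ IsUnit J ∧
      ∀ σ, ((r σ : GL (Fin 6) (PadicAlgCl ℓ)) : Matrix (Fin 6) (Fin 6) (PadicAlgCl ℓ))ᵀ * J *
        ((r σ : GL (Fin 6) (PadicAlgCl ℓ)) : Matrix (Fin 6) (Fin 6) (PadicAlgCl ℓ)) = J)
    (hdet : ∀ σ, FramedRep.det r σ = 1)
    (_hur : ∀ᶠ v : HeightOneSpectrum (𝓞 F) in Filter.cofinite, r.IsUnramifiedAt v) :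
    ∃ (W : FramedGaloisRep F (PadicAlgCl ℓ) 4) (ν : absoluteGaloisGroup F →ₜ* (PadicAlgCl ℓ)ˣ),
      ∀ σ, (ν σ : PadicAlgCl ℓ) * FramedRep.trace r σ =
          (FramedRep.trace W σ ^ 2 - FramedRep.trace W (σ * σ)) / 2 :=
  h F ℓ r hJ hdet

end API

end Literature.NumberTheory.GaloisRepresentations

end
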